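import Summits.ABC.ABC.Theses.PadicPrincipalCoreST86
import Summits.ABC.StewartYu.GluePrincipalToPrime
import HarnessLib

/-!
# Route PadicPrincipalCoreST86, item `GlueSpec`: closed by the cell's glue theorem

`Summits/ABC/ABC/Theorems/PadicPrincipalCoreST86Glue.lean` — cell `abc-stewartyu`, seat p3.
The support item `GlueSpec` of the rung route (WP-M output + any Theorem-A-shaped bound with
envelope `C(m) ≤ c₁^m m^{c₂ m}` ⟹ the one-prime bound at every odd prime with
`(κ, σ, τ, τ₁) = (c₂ + 2, 2, 2, 2)`) is the landed
`Summit.ABC.StewartYu.primePadicBoundAt_odd_of_principal` with `K = 4704`, `L = 32 c₁`.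
-/

set_option linter.dupNamespace false

namespace Summit.ABC.ABC.Theorems

/-- **Item `GlueSpec` of route PadicPrincipalCoreST86** (`K = 4704`, `L = 32c₁`, `κ = c₂ + 2`). [folklore] -/
theorem padicPrincipalCoreST86_glueSpec_proof : Summit.ABC.ABC.Theses.PadicPrincipalCoreST86.GlueSpec := by
  unfold Summit.ABC.ABC.Theses.PadicPrincipalCoreST86.GlueSpec
  intro hM C r c₁ c₂ hc₁ hc₂ hC hA
  refine ⟨4704, 32 * c₁, c₂ + 2, by norm_num, by linarith, by linarith, by linarith, ?_⟩
  intro p hp hp2 n q e hq hinj hqp he hne1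
  exact Summit.ABC.StewartYu.primePadicBoundAt_odd_of_principal hM hc₁ hC hA hp hp2 n q e hq hinj hqp
    he hne1

end Summit.ABC.ABC.Theorems
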